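import Summits.Ventures.PercRepro.Night2LocalDQPenultB

/-!
# PercRepro — Theorem E's open cell at `q = 6` for SIMPLE matroids (night-2, gen 11)

With the refined request bound `L1_le_penult` (`Night2LocalDQPenultB`): at `q = 6`, `k = 5`, a shadow set with
`5` coloops and `G ≠ S` has every covering-set loss `≤ req · 266/833` (`L₁ ≤ 17/63`, `cap ≥ 9/49`), so
`load₂ ≤ 76/833 + 2 · 2128/52479 < 9/49 ≤ cap₂`; if `G = S` the residual capacity is `1`.

* **`load2_le_cap2_of_five_six`**, **`localShadowHall_dq_six_five`** (`k = 5`),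
  **`localShadowHall_dq_six_of_simple`** (every `k`): the regime `|E ∖ G| = 6` at `q = 6` for loopless simple
  matroids — with `Night2LocalDQFour` / `Night2LocalDQFive`, Theorem E's gap `k = q − 1` is closed for simple
  matroids at every `q ≤ 6`.
-/

open scoped Matroid

namespace PercRepro.Shadow

open Finset PerFlat ThmH

variable {α : Type*} [DecidableEq α] {M : Matroid α} [M.Finite]

section Six

variable {G S : Finset α}

open scoped Classical in
/-- **The column bound at `q = 6`, `k = 5`, five coloops of `S`** (loopless simple `M`): `load₂(S) ≤ cap₂(S)`.
If `G = S` the residual capacity is `1`; otherwise the refined request bound `L₁ ≤ 17/63` at every covering set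
gives losses `≤ req · 266/833`, and `76/833 + 2 · 2128/52479 < 9/49`. -/
theorem load2_le_cap2_of_five_six (hs : ∀ e ∈ gr M, ∀ f ∈ gr M, e ≠ f → rkN M {e, f} = 2)
    (hl : ∀ e ∈ gr M, M.Indep {e}) (hG : G ∈ flatsQ M (6 + 1)) (hd : (gr M \ G).card = 6)
    (hk : kColoops M G = 5) (hS : S ∈ shadowAt M (6 + 2) 6 (Uq M (6 + 2) 6) G)
    (ha : (coloops M S).card = 5) : load2 M 6 G S ≤ cap2 M 6 G S := by
  have hSG : S ⊆ G := subset_of_mem_shadowAt hS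
  have hex : 2 * (ex2 M 6 G S).card ≤ (6 + 2 - 5) * (6 + 1 - 5) := by
    have := two_mul_card_ex2_le hG hS
    rwa [ha] at this
  have hex3 : (ex2 M 6 G S).card ≤ 3 := by omega
  have hstar : 2 * ((kColoops M G : ℚ) / ((((6 : ℕ) : ℚ) + 1) ^ 2 * ((((6 : ℕ) : ℚ) + 1) - (kColoops M G : ℚ))))
      = 5 / 49 := by
    rw [hk]; norm_num
  by_cases hGS : G = S
  · have hcap : cap2 M 6 G S = 1 := by subst hGS; exact cap2_self_eq_one hd
    have hload := load2_le_dq hG hd (by omega) S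
    rw [hstar] at hload
    have hex3' : ((ex2 M 6 G S).card : ℚ) ≤ 3 := by exact_mod_cast hex3
    rw [hcap]
    nlinarith [hload, hex3']
  · have hk1 : k1 M 6 G S ≤ 5 := hk ▸ k1_le_kColoops hSG
    have hcap := cap2_ge_dq hG hd hS
    rw [ha] at hcap
    have hcap' : (9 : ℚ) / 49 ≤ cap2 M 6 G S := by
      refine le_trans ?_ hcap
      have : (k1 M 6 G S : ℚ) ≤ 5 := by exact_mod_cast hk1
      norm_num
      linarith
    have hphi6 : phiQ 6 = 8 / 7 := by unfold phiQ; norm_num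
    -- the per-member bound
    have hw : ∀ B ∈ ex2 M 6 G S, w2 M 6 G B S ≤
        if (G \ clF M B).card = 2 then (76 : ℚ) / 833 else 2128 / 52479 := by
      intro B hB
      obtain ⟨hBm, hB0, hBS, hsub, hcard⟩ := mem_ex2_unpack hB
      have hm2 : 2 ≤ (G \ clF M B).card := hcard ▸ Finset.card_le_card hsub
      have hreq : req M 6 B = phiQ 6 / (((G \ clF M B).card : ℚ) + 6) := by
        unfold req
        rw [card_compl_clF_add hG (mem_membersIn.1 hBm).2, hd]
        push_cast
        rfl
      have hreq0 : 0 ≤ req M 6 B := req_nonneg 6 B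
      have hloss : ∀ z ∈ S \ B, loss M 6 G B z ≤ req M 6 B * ((266 : ℚ) / 833) := by
        intro z hz
        have hL := L1_le_penult hs hl hG hd hk hS ha (by norm_num) hGS hB hz
        have hL' : L1 M 6 G (insert z B) ≤ 17 / 63 := by
          refine hL.trans (le_of_eq ?_)
          rw [hphi6]; norm_num
        have hS'' : insert z B ⊆ G := (Finset.insert_subset (Finset.mem_sdiff.1 hz).1 hBS).trans hSG
        have hcapS : (9 : ℚ) / 49 ≤ capS M 6 G (insert z B) := by
          unfold capS
          rw [hd, hphi6]
          have : (k1 M 6 G (insert z B) : ℚ) ≤ 5 := by exact_mod_cast (hk ▸ k1_le_kColoops hS'')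
          norm_num
          linarith
        have := loss_le_of_L1_le hL' hcapS (by norm_num) (by norm_num)
        refine this.trans (le_of_eq ?_)
        norm_num
      have hsum : ∑ z ∈ S \ B, loss M 6 G B z ≤ 2 * (req M 6 B * ((266 : ℚ) / 833)) := by
        calc ∑ z ∈ S \ B, loss M 6 G B z ≤ ∑ _z ∈ S \ B, req M 6 B * ((266 : ℚ) / 833) :=
              Finset.sum_le_sum hloss
          _ = 2 * (req M 6 B * ((266 : ℚ) / 833)) := by
              rw [Finset.sum_const, hcard, nsmul_eq_mul]; push_cast; ring
      have hsum0 : 0 ≤ ∑ z ∈ S \ B, loss M 6 G B z :=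
        Finset.sum_nonneg (fun z _ => loss_nonneg (capS_nonneg' hG hd.le _))
      unfold w2
      rw [if_pos ⟨hB0, hBS, hsub, hcard⟩]
      split_ifs with h2
      · have hr : req M 6 B = 1 / 7 := by rw [hreq, h2, hphi6]; norm_num
        rw [h2]
        norm_num
        rw [hr] at hsum
        linarith
      · have h3 : (3 : ℚ) ≤ ((G \ clF M B).card : ℚ) := by
          have : 3 ≤ (G \ clF M B).card := by omega
          exact_mod_cast this
        have hr : req M 6 B ≤ 8 / 63 := by
          rw [hreq, hphi6, show (8 : ℚ) / 63 = 8 / 7 / 9 by norm_num]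
          apply div_le_div_of_nonneg_left (by norm_num) (by norm_num)
          linarith
        have hden : (2 : ℚ) ≤ ((G \ clF M B).card : ℚ) - 1 := by linarith
        calc (∑ z ∈ S \ B, loss M 6 G B z) / (((G \ clF M B).card : ℚ) - 1)
            ≤ (∑ z ∈ S \ B, loss M 6 G B z) / 2 := by
              apply div_le_div_of_nonneg_left hsum0 (by norm_num) hden
          _ ≤ (2 * (req M 6 B * ((266 : ℚ) / 833))) / 2 := by
              apply div_le_div_of_nonneg_right hsum (by norm_num)
          _ ≤ 2128 / 52479 := by nlinarith [hr, hreq0]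
    have hload : load2 M 6 G S ≤
        ∑ B ∈ ex2 M 6 G S, (if (G \ clF M B).card = 2 then (76 : ℚ) / 833 else 2128 / 52479) := by
      unfold load2
      rw [← Finset.sum_filter_ne_zero]
      exact Finset.sum_le_sum (fun B hB => hw B hB)
    rw [Finset.sum_ite, Finset.sum_const, Finset.sum_const, nsmul_eq_mul, nsmul_eq_mul] at hload
    -- at most one member of ex2 with |G ∖ cl B| = 2
    have hA : ((ex2 M 6 G S).filter (fun B => (G \ clF M B).card = 2)).card ≤ 1 := by
      rw [Finset.card_le_one]
      intro B₁ hB₁ B₂ hB₂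
      rw [Finset.mem_filter] at hB₁ hB₂
      by_contra hne
      obtain ⟨h1m, -, h1S, -, -⟩ := mem_ex2_unpack hB₁.1
      obtain ⟨h2m, -, h2S, -, -⟩ := mem_ex2_unpack hB₂.1
      exact hGS (eq_of_two_members_card_two (by norm_num) hs hl hG hd (by omega) hS (by omega) h1m h2m h1S
        h2S (sdiff_mem_seriesPairs hG hS hB₁.1) (sdiff_mem_seriesPairs hG hS hB₂.1) hne
        (sdiff_eq_of_mem_ex2 hB₁.1 hB₁.2).symm (sdiff_eq_of_mem_ex2 hB₂.1 hB₂.2).symm)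
    have hAC : ((ex2 M 6 G S).filter (fun B => (G \ clF M B).card = 2)).card +
        ((ex2 M 6 G S).filter (fun B => ¬ (G \ clF M B).card = 2)).card = (ex2 M 6 G S).card :=
      Finset.card_filter_add_card_filter_not _
    have hA' : (((ex2 M 6 G S).filter (fun B => (G \ clF M B).card = 2)).card : ℚ) ≤ 1 := by
      exact_mod_cast hA
    have hC' : (((ex2 M 6 G S).filter (fun B => (G \ clF M B).card = 2)).card : ℚ) +
        (((ex2 M 6 G S).filter (fun B => ¬ (G \ clF M B).card = 2)).card : ℚ) ≤ 3 := by
      have : ((ex2 M 6 G S).filter (fun B => (G \ clF M B).card = 2)).card +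
          ((ex2 M 6 G S).filter (fun B => ¬ (G \ clF M B).card = 2)).card ≤ 3 := by omega
      exact_mod_cast this
    have hA0 : (0 : ℚ) ≤ (((ex2 M 6 G S).filter (fun B => (G \ clF M B).card = 2)).card : ℚ) :=
      Nat.cast_nonneg _
    have hC0 : (0 : ℚ) ≤ (((ex2 M 6 G S).filter (fun B => ¬ (G \ clF M B).card = 2)).card : ℚ) :=
      Nat.cast_nonneg _
    calc load2 M 6 G S ≤ _ := hload
      _ ≤ 9 / 49 := by linarith
      _ ≤ cap2 M 6 G S := hcap'

/-- **Theorem E's open cell at `q = 6`**: the local form at a rank-`7` flat `G` with `|E ∖ G| = 6` whose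
restriction `M|G` has exactly `5` coloops, for a loopless simple matroid. -/
theorem localShadowHall_dq_six_five (hs : ∀ e ∈ gr M, ∀ f ∈ gr M, e ≠ f → rkN M {e, f} = 2)
    (hl : ∀ e ∈ gr M, M.Indep {e}) (hG : G ∈ flatsQ M (6 + 1)) (hd : (gr M \ G).card = 6)
    (hk : kColoops M G = 5) : LocalShadowHall M 6 G := by
  classical
  apply localShadowHall_of_distance_two hG hd.le
  intro S hS
  have hSG : S ⊆ G := subset_of_mem_shadowAt hS
  have hSE : S ⊆ gr M := hSG.trans (mem_flatsQ.1 hG).1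
  have ha5 : 5 ≤ (coloops M S).card := hk ▸ kColoops_le_card_coloops hS
  have ha7 : (coloops M S).card ≤ 6 + 1 :=
    card_coloops_le hSE (eRk_eq_of_mem_Yq_diag (mem_shadow.1 (mem_shadowAt.1 hS).1).1)
  have hcap0 : 0 ≤ cap2 M 6 G S := cap2_nonneg (capS_nonneg' hG hd.le S)
  obtain ⟨a, hadef⟩ : ∃ a, (coloops M S).card = a := ⟨_, rfl⟩
  have hcases : a = 5 ∨ a = 6 ∨ a = 7 := by omega
  rcases hcases with rfl | rfl | rfl
  · exact load2_le_cap2_of_five_six hs hl hG hd hk hS hadef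
  · have hex := ex2_eq_empty_of_card_coloops_eq hs hG hS hadef
    have hload := load2_le_dq hG hd (by omega) S
    rw [hex, Finset.card_empty, Nat.cast_zero, zero_mul] at hload
    exact hload.trans hcap0
  · have hex := two_mul_card_ex2_le hG hS
    rw [hadef] at hex
    have hex0 : (ex2 M 6 G S).card = 0 := by omega
    have hload := load2_le_dq hG hd (by omega) S
    rw [hex0, Nat.cast_zero, zero_mul] at hload
    exact hload.trans hcap0

/-- **The regime `|E ∖ G| = 6` at `q = 6` for every loopless simple matroid**: Theorem E (`k ≤ 4`),
`localShadowHall_of_kColoops` (`k ≥ 6`) and the cell `k = 5` above. -/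
theorem localShadowHall_dq_six_of_simple (hs : ∀ e ∈ gr M, ∀ f ∈ gr M, e ≠ f → rkN M {e, f} = 2)
    (hl : ∀ e ∈ gr M, M.Indep {e}) (hG : G ∈ flatsQ M (6 + 1)) (hd : (gr M \ G).card = 6) :
    LocalShadowHall M 6 G := by
  obtain ⟨k, hk⟩ : ∃ k, kColoops M G = k := ⟨_, rfl⟩
  by_cases h6 : 6 ≤ k
  · exact localShadowHall_of_kColoops hG hd.le (hk ▸ h6)
  · by_cases h5 : k = 5
    · exact localShadowHall_dq_six_five hs hl hG hd (hk.trans h5)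
    · apply localShadowHall_dq hG hd
      rw [hk]
      have : k ≤ 4 := by omega
      interval_cases k <;> norm_num

end Six

end PercRepro.Shadow
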